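import Summits.CriticalPhenomena.PercolationContinuityZ3.Theorems.PercNearOneGluingNoHeavyLowerTailSahiCombFiveUpSetProof
import Summits.CriticalPhenomena.PercolationContinuityZ3.Theorems.PercNearOneGluingNoHeavyLowerTailSahiCombFiveUpSetTriW

/-!
# The five-up-set inequality, RANK route III: the thin-edge one-cube triangle functional is non-negative on every cube (unconditional)

Support file of the one-cut programme (crux `NoHeavyLowerTail`, stmt-CriticalPhenomena-4575; lemma factory `prim-lf-1` gen 18; cell `prim-masterthm`
seat P5, report `P5-LORENTZIAN-TEST.md` §11.1–11.3, §11.10).  P5's `LatticeFiveUpSet.triWOne_nonneg_of_lattice` (`…SahiCombFiveUpSetTriW`) proves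
`0 ≤ triWOne` on every finite distributive lattice CONDITIONALLY on the lattice conjecture `FiveUpSetIneqLattice`.  On a cube `Finset γ` with the
complementation antipode the hypothesis is now the THEOREM `FiveUpSet.fiveUpSetIneq_holds` (`…SahiCombFiveUpSetProof`), so:

* **`FiveUpSet.triWOne_nonneg_cube`** — for up-sets `P`, `F₀ ⊆ F₁`, `G₀ ⊆ G₁` of `Finset γ`, `0 ≤ LatticeFiveUpSet.triWOne compl P F₀ F₁ G₀ G₁`;
  by report §11.3 (`TRI = ⟨C,D⟩_h + P_x`, cylinders over `2^b × 2^c = Finset (β ⊕ γ)`) this is `TRI ≥ 0` on every triangle-class cell `(1,b,c)` of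
  (M⁺⁺-3), all `b, c`, all `f, g, h` (previously computer-assisted for `b + c ≤ 7`).  The transport `Finset β × Finset γ ≃o Finset (β ⊕ γ)` and the class-T
  bridge `triWOne ↔ hybCoeff` (report §10.3) remain P5's.
HONEST LABEL: one unconditional corollary (std axioms); the lattice form (♠_L) and the cells with all blocks `≥ 2` (`TRI_W` for `a ≥ 2`, report §11.10) stay OPEN. [this work]
-/

namespace Summit.CriticalPhenomena.PercolationContinuityZ3.Theorems

namespace FiveUpSet

open Finset

/-- **`TRI_W ≥ 0` at a thin edge on every cube, unconditionally.**  For a finite cube `Finset γ` with the complementation antipode and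
up-sets `P`, `F₀ ⊆ F₁`, `G₀ ⊆ G₁`, the one-cube triangle functional of `…SahiCombFiveUpSetTriW` satisfies
`0 ≤ LatticeFiveUpSet.triWOne compl P F₀ F₁ G₀ G₁` (report §11.3: (♠) ⟹ `P_x ≥ 0` ⟹ `TRI ≥ 0` on every triangle-class cell with a block of
size one; previously conditional on `FiveUpSetIneqLattice`, or computer-assisted for `b + c ≤ 7`).  Proof: `triWOne_eq`, the five-up-set
inequality for the slack, and two Kleitman gaps. [this work] -/
theorem triWOne_nonneg_cube (γ : Type) [DecidableEq γ] [Fintype γ] (P F₀ F₁ G₀ G₁ : Finset (Finset γ))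
    (hP : IsUpperSet (P : Set (Finset γ))) (hF₀ : IsUpperSet (F₀ : Set (Finset γ))) (hF₁ : IsUpperSet (F₁ : Set (Finset γ)))
    (hG₀ : IsUpperSet (G₀ : Set (Finset γ))) (hG₁ : IsUpperSet (G₁ : Set (Finset γ))) (hF : F₀ ⊆ F₁) (hG : G₀ ⊆ G₁) :
    0 ≤ LatticeFiveUpSet.triWOne (⟨compl, compl, compl_compl, compl_compl⟩ : Finset γ ≃ Finset γ) P F₀ F₁ G₀ G₁ := by
  set τ : Finset γ ≃ Finset γ := ⟨compl, compl, compl_compl, compl_compl⟩ with hτdef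
  have er : ∀ 𝒜 : Finset (Finset γ), 𝒜.image τ = refl 𝒜 := by
    intro 𝒜
    ext s
    rw [mem_refl, mem_image]
    constructor
    · rintro ⟨t, ht, rfl⟩
      simpa [hτdef] using ht
    · intro hs
      exact ⟨sᶜ, hs, compl_compl s⟩
  rw [LatticeFiveUpSet.triWOne_eq τ P F₀ F₁ G₀ G₁ hF hG]
  simp only [er]
  have hs := fiveUpSetIneq_holds γ P F₀ F₁ G₀ G₁ hP hF₀ hF₁ hG₀ hG₁ hF hG
  rw [refl_sdiff, refl_sdiff] at hs ⊢
  have hPG₀ : IsUpperSet ((P ∩ G₀ : Finset (Finset γ)) : Set (Finset γ)) := by rw [coe_inter]; exact hP.inter hG₀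
  have hPF₀ : IsUpperSet ((P ∩ F₀ : Finset (Finset γ)) : Set (Finset γ)) := by rw [coe_inter]; exact hP.inter hF₀
  have k1 := card_inter_refl_le hPG₀ hF₁
  have k2 := card_inter_refl_le hPF₀ hG₁
  have e1 : P ∩ G₀ ∩ refl F₁ = P ∩ refl F₁ ∩ G₀ := by
    rw [inter_assoc, inter_comm G₀, ← inter_assoc]
  have e2 : P ∩ G₀ ∩ F₁ = P ∩ F₁ ∩ G₀ := by
    rw [inter_assoc, inter_comm G₀, ← inter_assoc]
  rw [e1, e2] at k1
  omega

end FiveUpSet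

end Summit.CriticalPhenomena.PercolationContinuityZ3.Theorems
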